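import Summits.ValiantsHypothesis.ValiantsHypothesis.Theorems.KPlusLogSqLawTropicalBIteratedHalving
import Summits.ValiantsHypothesis.ValiantsHypothesis.Theorems.LacunarySymmetroidMatrixDescartesCensusTropicalKLawStatic

/-!
# Route `KPlusLogSqLaw`, crux `TropicalB` — STATIC halving: a static design (an integer parametric-ASSIGNMENT instance,
# i.e. a plane shadow of the Birkhoff polytope) of size `m` has fewer than `4^(m−1)` dominant terms, WHATEVER the number of
# classes

HONEST FRAMING.  Helper file toward the registered stubs `stub_tropThin` / `stub_tropFat` / `stub_tropStaticDiagonal` of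
`Cruxes/TropicalB/Lines/birth.lean` (crux `Summit.ValiantsHypothesis.ValiantsHypothesis.Theses.KPlusLogSqLaw.TropicalB`,
ledger item `stmt-ValiantsHypothesis-19771`, route `KPlusLogSqLaw`; cell `pub-symmetroid`, seat `val-sym-trop-p4` g6,
2026-08-27).  Census ceilings for STATIC designs only (the `TropRootLawAtStatic` currency of the static reduction p410710 and of
the content stub `stub_tropStaticDiagonal`); nothing here proves a stub or asserts `TropicalB`, `KPlusLogSqLaw`, `WeakLifting`,
`MatrixDescartes` or anything about `VP ≠ VNP`; at the diagonal `m = 2^s·s²` the bound `4^(m−1)` is useless (the stub asks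
`2^(C·s²)`).

WHAT IS PROVED.  The split inequality `designRowD_split` (…TropicalBSplit, all `a`-subsets of rows as states) restricted to STATIC
designs (`IsStatic ε`: every entry carries at most one present class), where the restricted sub-designs are again static and a
static `1 × 1` design has ONE present term:

* `static_split` — if every static design of size `a` has unsigned row bound `B₁` and every static design of size `e` has `B₂`,
  then every static design of size `a + e` has unsigned row bound `C(a+e, a)·(B₁ + B₂ + 1) − 1` (for ALL `K`, `d`).
* the EXACT static halving rows (`K`-free): sizes `1, 2, 3, 4, 5, 6, 7, 8` have at most `1, 2, 6, 18, 70, 220, 805, 2450` dominant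
  terms along any unsigned chain (`static_row_one … static_row_eight`: `DesignRowD … 0 / 1 / 5 / 17 / 69 / 219 / 804 / 2449`) —
  against the permutation count `m!` (`1, 2, 6, 24, 120, 720, 5040, 40320`; a static term is determined by its permutation):
  of the `24` permutation lines of a `4 × 4` parametric assignment instance at most `18` are unique optima at some slope.
* **`static_designRowD_four_pow : IsStatic ε → DesignRowD d v ε (4^(m−1) − 1)`** for every static design of every format `(m, K)`,
  and the signed row `tropRootLawAtStatic_four_pow : TropRootLawAtStatic m K (4^(m−1) − 1)` for ALL `m, K` — the census form of
  the upper half of Hrubeš–Yehudayoff 2021 Prop. 23 (`σ(DS_m) ≤ 2^{O(m)}`, discharged in the tree's own rendering as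
  `Literature.….HrubesYehudayoff2021_prop23_upper_holds`), here with the explicit constant `4^(m−1)` and in the dominance
  vocabulary of the crux; compare the general (non-static) iterated halving `T_D(m,K) + 1 ≤ 4^(m−1)·K` (…TropicalBIteratedHalving):
  staticity removes the factor `K`.
[folklore: Hrubeš–Yehudayoff 2021 Prop. 23, doi:10.4230/LIPIcs.CCC.2021.9, in the dominance vocabulary]
-/

set_option linter.dupNamespace false
set_option autoImplicit false

namespace Summit.ValiantsHypothesis.ValiantsHypothesis.Theorems.KPlusLogSqLaw

open Summit.ValiantsHypothesis.ValiantsHypothesis.Theorems.MatrixDescartes.Negative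
open Summit.ValiantsHypothesis.ValiantsHypothesis.Theorems.LacunarySymmetroidMatrixDescartes
open Summit.ValiantsHypothesis.ValiantsHypothesis.Theorems.LacunarySymmetroidMatrixDescartes.TropicalCensus
open scoped BigOperators
open Finset

namespace StaticHalving

/-! ## 1. Static restrictions and the base sizes -/

/-- a restriction of a static design (rows and columns re-indexed) is static. [folklore] -/
theorem isStatic_restrict {m m' K : ℕ} {ε : Fin m → Fin m → Fin K → ℤ} (h : IsStatic ε) (r c : Fin m' → Fin m) :
    IsStatic (fun i j l => ε (r i) (c j) l) :=
  fun i j l l' h1 h2 => h (r i) (c j) l l' h1 h2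

/-- size `0`: one term, no breakpoint. [folklore] -/
theorem static_row_zero {K : ℕ} (d : Fin K → ℕ) (v ε : Fin 0 → Fin 0 → Fin K → ℤ) : DesignRowD d v ε 0 := by
  intro n θ p hθ hdom hne
  rcases Nat.eq_zero_or_pos n with h | h
  · omega
  · exact absurd (Subsingleton.elim _ _) (hne ⟨0, h⟩)

/-- size `1`, static: the single entry carries one present class, so there is one present term and no breakpoint. [folklore] -/
theorem static_row_one {K : ℕ} (d : Fin K → ℕ) (v ε : Fin 1 → Fin 1 → Fin K → ℤ) (hs : IsStatic ε) :
    DesignRowD d v ε 0 := by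
  intro n θ p hθ hdom hne
  rcases Nat.eq_zero_or_pos n with h | h
  · omega
  · exfalso
    apply hne ⟨0, h⟩
    have hpres : ∀ k, ε 0 0 ((p k).2 0) ≠ 0 := by
      intro k
      have h1 := (termSign_ne_zero_iff ε (p k)).mp (hdom k).1 0
      rwa [Subsingleton.elim ((p k).1 0) 0] at h1
    have hcl : (p (Fin.castSucc ⟨0, h⟩)).2 0 = (p (Fin.succ ⟨0, h⟩)).2 0 := hs 0 0 _ _ (hpres _) (hpres _)
    refine Prod.ext (Subsingleton.elim _ _) (funext fun i => ?_)
    rw [Subsingleton.elim i 0]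
    exact hcl

/-! ## 2. The static split -/

/-- **Static split (all `a`-subsets as states).**  If every static design of size `a` has unsigned row bound `B₁` and every static
design of size `e` has unsigned row bound `B₂` (each for the given `K`, `d`), then every static design of size `a + e` has unsigned
row bound `C(a+e,a)·(B₁ + B₂ + 1) − 1`. [folklore: doi:10.4230/LIPIcs.CCC.2021.9 Prop. 23 in the dominance vocabulary] -/
theorem static_split {a e K : ℕ} (d : Fin K → ℕ) {B₁ B₂ : ℕ}
    (h₁ : ∀ (v ε : Fin a → Fin a → Fin K → ℤ), IsStatic ε → DesignRowD d v ε B₁)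
    (h₂ : ∀ (v ε : Fin e → Fin e → Fin K → ℤ), IsStatic ε → DesignRowD d v ε B₂)
    (v ε : Fin (a + e) → Fin (a + e) → Fin K → ℤ) (hs : IsStatic ε) :
    DesignRowD d v ε ((a + e).choose a * (B₁ + B₂ + 1) - 1) := by
  classical
  have hcard : ((univ : Finset (Fin (a + e))).powersetCard a).card = (a + e).choose a := by
    rw [card_powersetCard, card_univ, Fintype.card_fin]
  rw [← hcard]
  refine designRowD_split d v ε _ (fun R hR => (mem_powersetCard.mp hR).2)
    (fun R _ r _ => h₁ _ _ (isStatic_restrict hs _ _)) (fun R _ r _ => h₂ _ _ (isStatic_restrict hs _ _)) ?_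
  intro q _
  rw [mem_powersetCard]
  exact ⟨subset_univ _, card_image_castAdd q⟩

/-! ## 3. The exact static halving rows, sizes `2 … 8` (for every `K` and `d`) -/

/-- static size `2`: at most `2` dominant terms (`1` breakpoint). [folklore] -/
theorem static_row_two {K : ℕ} (d : Fin K → ℕ) (v ε : Fin 2 → Fin 2 → Fin K → ℤ) (hs : IsStatic ε) : DesignRowD d v ε 1 := by
  have h := static_split (a := 1) (e := 1) d (fun v ε hs => static_row_one d v ε hs) (fun v ε hs => static_row_one d v ε hs) v ε hs
  rwa [show Nat.choose (1 + 1) 1 = 2 by decide] at h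

/-- static size `3`: at most `6` dominant terms (`5` breakpoints; `= 3!`, no gain yet). [folklore] -/
theorem static_row_three {K : ℕ} (d : Fin K → ℕ) (v ε : Fin 3 → Fin 3 → Fin K → ℤ) (hs : IsStatic ε) : DesignRowD d v ε 5 := by
  have h := static_split (a := 1) (e := 2) d (fun v ε hs => static_row_one d v ε hs) (fun v ε hs => static_row_two d v ε hs) v ε hs
  rwa [show Nat.choose (1 + 2) 1 = 3 by decide] at h

/-- **static size `4`: at most `18` dominant terms (`17` breakpoints) of the `24` permutation terms.** [folklore] -/
theorem static_row_four {K : ℕ} (d : Fin K → ℕ) (v ε : Fin 4 → Fin 4 → Fin K → ℤ) (hs : IsStatic ε) : DesignRowD d v ε 17 := by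
  have h := static_split (a := 2) (e := 2) d (fun v ε hs => static_row_two d v ε hs) (fun v ε hs => static_row_two d v ε hs) v ε hs
  rwa [show Nat.choose (2 + 2) 2 = 6 by decide] at h

/-- static size `5`: at most `70` dominant terms (`69` breakpoints; `5! = 120`). [folklore] -/
theorem static_row_five {K : ℕ} (d : Fin K → ℕ) (v ε : Fin 5 → Fin 5 → Fin K → ℤ) (hs : IsStatic ε) : DesignRowD d v ε 69 := by
  have h := static_split (a := 2) (e := 3) d (fun v ε hs => static_row_two d v ε hs) (fun v ε hs => static_row_three d v ε hs) v ε hs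
  rwa [show Nat.choose (2 + 3) 2 = 10 by decide] at h

/-- static size `6`: at most `220` dominant terms (`219` breakpoints; `6! = 720`). [folklore] -/
theorem static_row_six {K : ℕ} (d : Fin K → ℕ) (v ε : Fin 6 → Fin 6 → Fin K → ℤ) (hs : IsStatic ε) : DesignRowD d v ε 219 := by
  have h := static_split (a := 3) (e := 3) d (fun v ε hs => static_row_three d v ε hs) (fun v ε hs => static_row_three d v ε hs)
    v ε hs
  rwa [show Nat.choose (3 + 3) 3 = 20 by decide] at h

/-- static size `7`: at most `805` dominant terms (`804` breakpoints; `7! = 5040`). [folklore] -/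
theorem static_row_seven {K : ℕ} (d : Fin K → ℕ) (v ε : Fin 7 → Fin 7 → Fin K → ℤ) (hs : IsStatic ε) : DesignRowD d v ε 804 := by
  have h := static_split (a := 3) (e := 4) d (fun v ε hs => static_row_three d v ε hs) (fun v ε hs => static_row_four d v ε hs) v ε hs
  rwa [show Nat.choose (3 + 4) 3 = 35 by decide] at h

/-- static size `8`: at most `2450` dominant terms (`2449` breakpoints; `8! = 40320`). [folklore] -/
theorem static_row_eight {K : ℕ} (d : Fin K → ℕ) (v ε : Fin 8 → Fin 8 → Fin K → ℤ) (hs : IsStatic ε) :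
    DesignRowD d v ε 2449 := by
  have h := static_split (a := 4) (e := 4) d (fun v ε hs => static_row_four d v ε hs) (fun v ε hs => static_row_four d v ε hs) v ε hs
  rwa [show Nat.choose (4 + 4) 4 = 70 by decide] at h

/-! ## 4. The uniform static bound `4^(m−1) − 1` -/

/-- **STATIC HALVING LAW**: every static design of format `(m, K)` has unsigned row bound `4^(m−1) − 1` — fewer than `4^(m−1)`
dominant terms along any chain of consecutive-distinct unique optima at increasing integer slopes, uniformly in `K`.  Balanced static
split down to size `1`, closed by `2·C(2a,a) ≤ 4^a` and `5·C(2a+1,a) ≤ 4^(a+1)` (…TropicalBIteratedHalving).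
[folklore: Hrubeš–Yehudayoff 2021 Prop. 23, upper half, in the dominance vocabulary] -/
theorem static_designRowD_four_pow : ∀ (m K : ℕ) (d : Fin K → ℕ) (v ε : Fin m → Fin m → Fin K → ℤ),
    IsStatic ε → DesignRowD d v ε (4 ^ (m - 1) - 1) := by
  intro m
  induction m using Nat.strong_induction_on with
  | _ m ih =>
    intro K d v ε hs
    rcases Nat.lt_or_ge m 2 with hm | hm
    · interval_cases m
      · simpa using static_row_zero d v ε
      · simpa using static_row_one d v ε hs
    obtain ⟨a, e, rfl, hae, hea, ha⟩ : ∃ a e, m = a + e ∧ a ≤ e ∧ e ≤ a + 1 ∧ 1 ≤ a :=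
      ⟨m / 2, m - m / 2, by omega, by omega, by omega, by omega⟩
    have hIa := fun (v ε : Fin a → Fin a → Fin K → ℤ) (hs : IsStatic ε) => ih a (by omega) K d v ε hs
    have hIe := fun (v ε : Fin e → Fin e → Fin K → ℤ) (hs : IsStatic ε) => ih e (by omega) K d v ε hs
    refine designRowD_mono ?_ (static_split d hIa hIe v ε hs)
    have hX : 1 ≤ 4 ^ (a - 1) := Nat.one_le_pow _ _ (by norm_num)
    have hY : 1 ≤ 4 ^ (e - 1) := Nat.one_le_pow _ _ (by norm_num)
    refine IteratedHalving.halving_arith hX hY ?_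
    rcases Nat.eq_or_lt_of_le hae with heq | hlt
    · -- even split `e = a`
      subst heq
      have e1 : 4 ^ (a + a - 1) = 4 ^ a * 4 ^ (a - 1) := by rw [← pow_add]; congr 1; omega
      rw [e1]
      calc (a + a).choose a * (4 ^ (a - 1) + 4 ^ (a - 1)) = 2 * (a + a).choose a * 4 ^ (a - 1) := by ring
        _ ≤ 4 ^ a * 4 ^ (a - 1) := Nat.mul_le_mul_right _ (IteratedHalving.two_mul_choose_self_add_le_four_pow a ha)
    · -- odd split `e = a + 1`
      have he : e = a + 1 := by omega
      subst he
      have e1 : 4 ^ (a + (a + 1) - 1) = 4 ^ (a + 1) * 4 ^ (a - 1) := by rw [← pow_add]; congr 1; omega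
      have e2 : 4 ^ (a + 1 - 1) = 4 * 4 ^ (a - 1) := by rw [← pow_succ']; congr 1; omega
      have e3 : a + (a + 1) = 2 * a + 1 := by ring
      rw [e1, e2, e3]
      calc (2 * a + 1).choose a * (4 ^ (a - 1) + 4 * 4 ^ (a - 1)) = 5 * (2 * a + 1).choose a * 4 ^ (a - 1) := by ring
        _ ≤ 4 ^ (a + 1) * 4 ^ (a - 1) := Nat.mul_le_mul_right _ (IteratedHalving.five_mul_choose_le_four_pow a ha)

/-- **STATIC HALVING LAW, signed row**: `TropRootLawAtStatic m K (4^(m−1) − 1)` for ALL `m, K`. [folklore] -/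
theorem tropRootLawAtStatic_four_pow (m K : ℕ) : TropRootLawAtStatic m K (4 ^ (m - 1) - 1) :=
  fun d v ε _ θ p _ hs hθ hdom halt => le_of_designRowD (static_designRowD_four_pow m K d v ε hs) θ p hθ hdom halt

/-- the static size-`4` row, signed: `TropRootLawAtStatic 4 K 17` for every `K`. [folklore] -/
theorem tropRootLawAtStatic_four (K : ℕ) : TropRootLawAtStatic 4 K 17 :=
  fun d v ε _ θ p _ hs hθ hdom halt => le_of_designRowD (static_row_four d v ε hs) θ p hθ hdom halt

/-- the static size-`5` row, signed: `TropRootLawAtStatic 5 K 69` for every `K`. [folklore] -/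
theorem tropRootLawAtStatic_five (K : ℕ) : TropRootLawAtStatic 5 K 69 :=
  fun d v ε _ θ p _ hs hθ hdom halt => le_of_designRowD (static_row_five d v ε hs) θ p hθ hdom halt

/-- the static size-`6` row, signed: `TropRootLawAtStatic 6 K 219` for every `K`. [folklore] -/
theorem tropRootLawAtStatic_six (K : ℕ) : TropRootLawAtStatic 6 K 219 :=
  fun d v ε _ θ p _ hs hθ hdom halt => le_of_designRowD (static_row_six d v ε hs) θ p hθ hdom halt

/-- the static rows beat the permutation count `m!` from size `4` on: `18 < 24`, `70 < 120`, `220 < 720`, `805 < 5040`,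
`2450 < 40320`. [arithmetic] -/
theorem static_rows_lt_factorial :
    18 < Nat.factorial 4 ∧ 70 < Nat.factorial 5 ∧ 220 < Nat.factorial 6 ∧ 805 < Nat.factorial 7 ∧ 2450 < Nat.factorial 8 := by
  decide

end StaticHalving

end Summit.ValiantsHypothesis.ValiantsHypothesis.Theorems.KPlusLogSqLaw
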